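import Mathlib.RingTheory.PowerSeries.PiTopology
import Literature.NumberTheory.Automorphic.Eigenvariety
import Literature.NumberTheory.Automorphic.LocalComponentBJ
import Literature.NumberTheory.Automorphic.ParabolicGL
import Literature.NumberTheory.GaloisRepresentations.Pseudocharacter
import HarnessLib

/-!
# The eigenvariety of `Res_{K/ℚ} GL_n`: functions, arcs, weight jets, refined classical points

Topic `Literature/NumberTheory/Automorphic` (definition item `defn-EigenvarietyResGLn`, wanted by
route `Langlands/WeightVelocityMonodromy`, cruxes `WeightVelocityAtSteinbergPairs` and
`StrictTriangulationAtX`; shared with routes `NewtonPatching`, `BianchiArtinPoints`).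

Let `K` be a number field, `n ≥ 1`, `p` a prime, `K^p` a tame level with bad places
`S = S(K^p) ⊇ {v ∣ p}`, and fix uniformisers `ϖ_v`, `v ∣ p` (Hansen, §1.1: "after choosing a
uniformizer `ϖ_v` of `𝒪_v` for each `v ∣ p`").  Hansen constructs the eigenvariety
`𝒳 = 𝒳_{G,K^p}` of `G = Res_{K/ℚ} GL_n` from overconvergent cohomology: a separated rigid space
with a weight morphism `w : 𝒳 → 𝒲_{K^p}`, `𝒲_{K^p}(A) = Hom_cts(T(ℤ_p), Aˣ)` trivial on the closure
of `Z(K^p I)` (the global central units in the level), `T(ℤ_p) = ∏_{v∣p} (𝒪_{K_v}ˣ)ⁿ`, an algebra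
map `φ_𝒳 : 𝐓(K^p) = 𝒜_p^+ ⊗ 𝐓^p(K^p) → 𝒪(𝒳)` and a global character
`δ_𝒳 : T(ℚ_p) → 𝒪(𝒳)ˣ` specialising at every point `x` to the parameter `δ_x`
(`δ_x(ϖ_v,…,ϖ_v,1,…,1) = φ_x(U_{v,i})` and `δ_x|_{T(ℤ_p)}` the reindexed, twisted weight)
[cite: HansenUniversalEigenvarieties2017, Thm. 1.1.2, §1.2 (i)–(ii), §2.2, Def. 4.3.2, Thm. 4.3.3];
for `K` CM or totally real Johansson–Newton glue Scholze's determinants into an `n`-dimensional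
continuous Galois determinant `D : Γ_K → 𝒪⁺(𝒳^red)` with `D(1 − X Frob_v) = P_v(X)` for
`v ∉ S` [cite: JohanssonNewton2019, Thm. B and Thm. 5.4.5]; Bellaïche–Chenevier axiomatise an
eigenvariety abstractly as `(X, ψ : ℋ → 𝒪(X), ω : X → 𝒲, Z)` with `Z` the classical points
attached to `p`-refined automorphic representations `(π, ℛ)`, `ℛ` an *accessible refinement*
(a character occurring in the Jacquet module of `π_p`), and show such an object is unique
[cite: BellaicheChenevier2009, Def. 6.4.6, Def. 7.2.1–7.2.3, Def. 7.2.5, Prop. 7.2.7].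

Neither rigid-analytic geometry nor overconvergent cohomology exists in Mathlib or in this tree,
so — as the item asks ("INTERFACE (structure + axioms, construction statement separate)") and
exactly as for the accepted points-level `Literature.NumberTheory.Automorphic.Eigenvariety` —
this file fixes the TYPE of the datum and the PROPERTIES the constructions enjoy, and proves the
elementary API.  What is new relative to `Eigenvariety` (which this structure `extends`, so that
`HasNewtonBound`, `HasGaloisFamily`, `MatchesCuspidal`, `rhoBarPart`, … apply verbatim through
`toEigenvariety`) is the **analytic structure seen through global functions**:

* `Fn` — the topological ring `𝒪(𝒳^red)` with the evaluations `eval x : Fn →+* ℚ̄_p` at the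
  points, jointly injective (`𝒳^red` is reduced and rigid points are dense), the Hecke
  functions `heckeFn v i = φ_𝒳(T_{v,i})`, the universal character `paramFn = δ_𝒳` and the
  pseudocharacter `traceFn` of the Johansson–Newton determinant, each specialising at `x` to the
  point data of `Eigenvariety` (`eval_heckeFn`, `eval_paramFn`, `eval_traceFn`);
* **arcs** (DERIVED, no axiom): `arcs x` is the set of continuous ring homomorphisms
  `γ : Fn →+* ℚ̄_p⟦X⟧` whose constant term is `eval x` — the formal arcs `(Spf ℚ̄_p⟦X⟧, 0) → (𝒳, x)`
  (an analytic arc `γ : (𝔻, 0) → (𝒳, x)` gives `𝒪(𝒳) → 𝒪(𝔻) ↪ ℚ̄_p⟦X⟧`; conversely a continuous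
  lift of `eval x` factors through `𝒪̂_{𝒳,x}`); the constant arc shows `arcs x ≠ ∅`
  (`constArc_mem_arcs`).  Along an arc the families pull back: `arcParam` (`δ` along `γ`, an
  `n`-tuple per `v ∣ p` of continuous characters `K_vˣ → ℚ̄_p⟦X⟧ˣ`, coefficientwise topology),
  `arcWeight`, `arcHecke`, `arcTrace`, with the specialisation lemmas at `X = 0`;
* **jets** (pure algebra, fully proved): for a one-parameter family of characters
  `χ : G →ₜ* L⟦X⟧ˣ`, `charJet χ m g = coeff_m(χ(g)/χ(g)(0))`; if `χ ≡ χ(0) mod X^m` then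
  `charJet χ m` is an additive character (`charJet_mul`), whence the **leading jet**
  `leadingJet χ : G → L` (`leadingJet_mul`, `leadingJet_one`) — the "leading-order jet
  `d/ds (κ ∘ γ)`" of crux `WeightVelocityAtSteinbergPairs` is `leadingJet (E.arcWeight γ hγ v i)`,
  and the jet of a gap/ratio `δ_i δ_j⁻¹` along `γ` is `E.gapJet`;
* **refined classical points**: the primitive relation `IsClassicalPointOf ι x π χ` ("`x` is the
  point `x(π, χ)` attached through `ι : ℚ̄_p ≃ ℂ` to the cuspidal `π` refined by the exponent
  `χ = (χ_v)_{v∣p}` of the Jacquet modules of its local components", Bellaïche–Chenevier's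
  `(π, ℛ) ↦ z`), with the axioms: `x` is classical, regular algebraic with matching Hecke
  polynomials away from `S` (so `MatchesCuspidal`), every `χ_v` is an exponent of the Jacquet
  module of a local component `π_v` (`IsJacquetExponent`, the tree's `Representation.jacquetGL`
  for the Borel — Bellaïche–Chenevier Def. 6.4.6: the accessible refinements are
  `χ_v δ_B^{-1/2}`), and the two uniqueness statements `x(π,χ) = x(π,χ')` ⇒ …
  (`eq_of_isClassicalPointOf`, `exponent_eq_of_isClassicalPointOf`: Bellaïche–Chenevier
  Rem. 7.2.4 and Lemma 7.2.8 (c), Hansen Thm. 4.3.3); the `U`-part of `δ_x`,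
  `refinement x v i = δ_{x,v,i}(ϖ_v)` (so `uEigenvalue x v i = φ_x(U_{v,i})`, Hansen §1.2 (i)), is
  intrinsic;
* the subsets `noncritical`, `interior`, `regular` of classical points (Hansen Def. 3.2.3 and
  §1.1), the uniformisers `unif`, and, on the weight side (concrete): `PAdicWeight.centralValue`,
  `IsAlgebraicCharacter`, `PAdicWeight.IsArithmetic` (Hansen §3.2: `λ = λ^alg ε`).

The properties, one predicate each (so that a route states which package it posits; none is
asserted): `HasDiscreteWeightFibres` and `HasFiniteSlopeFibres` (Hansen Thm. 1.1.2 (i) and the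
finiteness remark after Def. 1.1.1), `HasClassicalDefect l₀` (`l(x) = l(G)` at interior
non-critical regular classical points, Hansen §1.1 p. 7, so that the inherited
`HasNewtonBoundWith d` reads `dim_x 𝒳 ≥ d − l₀` there, Thm. 1.1.6), `HasWeightsOfLevel U`
(weights trivial on the central global units of the level, in Hansen's normalisation §1.2 (ii)
of `δ_x|_{T(ℤ_p)}` — hence the sign `N_{K/ℚ}(u)^{n(n-1)/2}`), `HasRefinedClassicalPoints`
(the existence half of Bellaïche–Chenevier Def. 7.2.5 (iii) for a chosen class of refined `π`).

## What is deliberately NOT here (and why)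

* The KPX global triangulation of `D_rig(D|_{Γ_{K_v}})` over a proper birational modification
  [cite: KedlayaPottharstXiao2014, Cor. 6.3.10, Thm. 6.3.13] and "`x` lies off the bad locus":
  they need `(φ, Γ)`-modules over relative Robba rings (item `defn-PhiGammaModuleRobba`).  The
  Galois family ALONG ARCS is provided (`arcTrace γ hγ : ContinuousPseudocharacter Γ_K ℚ̄_p⟦X⟧ n`,
  base-change it to `ℚ̄_p[X]/X^{m+1}`), so that statement is one line once `D_rig` exists.
* Stability under `p`-adic twisting (Hansen §4.6, `𝒳 ≅ 𝒳⁰ ×` wild twists for `F = ℚ`): needs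
  `p`-adic Hecke characters of `K` with their local components; not in the tree.
* The dictionary between `refinement x v` (the `U`-values `δ_{x,v,i}(ϖ_v)`) and the exponent
  `χ_v` / the Langlands parameter of `π_v` (Hansen Prop. 5.2.1: `𝒜_p(u_i) = p^{1-i} φ_{σ(i)}`;
  Bellaïche–Chenevier (7.2.2): `ψ_p|_U = χ δ_B^{-1/2} δ_κ`): it is a fixed `⋆`-twist by the weight
  and powers of `q_v`, convention-laden and not unfolded; the relation `IsClassicalPointOf` is
  pinned instead by its uniqueness axioms.  Likewise `param`/`weight` follow the conventions of
  `Eigenvariety` (`weight x = δ_x|_{T(ℤ_p)}`, which is Hansen's `λ_x` reindexed `i ↔ n+1-i`,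
  inverted and twisted by `𝐍^{1-i}`, §1.2 (ii)); jets of `weight` and of `λ` differ by that fixed
  linear change of coordinates (the twist is constant along arcs).
* Labelled (Hodge–Tate) coordinates of jets `Hom_cts(𝒪_{K_v}ˣ, E) ≅ ⊕_τ E·τ`: needs the `p`-adic
  logarithm of `K_v` (absent); jets are delivered as additive characters of `𝒪_{K_v}ˣ` / `K_vˣ`.
* No existence statement: over an interface "there is a datum with property P" is vacuous, so
  none is minted (D-0026); the meaningful package is the route's crux over this vocabulary.

## References

* D. Hansen (appendix by J. Newton), *Universal eigenvarieties, trianguline Galois representations,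
  and p-adic Langlands functoriality*, J. reine angew. Math. 730 (2017), arXiv:1412.1533.
  [HansenUniversalEigenvarieties2017]
* C. Johansson, J. Newton, *Extended eigenvarieties for overconvergent cohomology*, Algebra &
  Number Theory 13 (2019), arXiv:1604.07739. [JohanssonNewton2019]
* J. Bellaïche, G. Chenevier, *Families of Galois representations and Selmer groups*, Astérisque
  324 (2009), arXiv:math/0602340. [BellaicheChenevier2009]
* K. Kedlaya, J. Pottharst, L. Xiao, *Cohomology of arithmetic families of (φ,Γ)-modules*, JAMS 27
  (2014), arXiv:1203.5718. [KedlayaPottharstXiao2014]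
-/

noncomputable section

open scoped NumberField Polynomial PowerSeries.WithPiTopology
open Field IsDedekindDomain PowerSeries

namespace Literature.NumberTheory.Automorphic

/-! ### Jets of one-parameter families of characters -/

section Jets

variable {L : Type*} [Field L]

/-- The **normalised series** `f · f(0)⁻¹ = 1 + a₁X + a₂X² + …` of a unit `f ∈ L⟦X⟧ˣ` (written with
the constant coefficient of the inverse unit, `f(0)⁻¹ = (f⁻¹)(0)`). [folklore] -/
def unitNormalize (f : (L⟦X⟧)ˣ) : L⟦X⟧ :=
  (f : L⟦X⟧) * C (constantCoeff ((f⁻¹ : (L⟦X⟧)ˣ) : L⟦X⟧))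

/-- The normalised series has constant term `1`. [folklore] -/
@[simp] theorem constantCoeff_unitNormalize (f : (L⟦X⟧)ˣ) :
    constantCoeff (unitNormalize f) = 1 := by
  rw [unitNormalize, map_mul, constantCoeff_C, ← map_mul, Units.mul_inv, map_one]

/-- Normalisation is multiplicative. [folklore] -/
theorem unitNormalize_mul (f g : (L⟦X⟧)ˣ) :
    unitNormalize (f * g) = unitNormalize f * unitNormalize g := by
  simp only [unitNormalize, Units.val_mul, mul_inv_rev, map_mul]
  ring

/-- The normalised series of `1` is `1`. [folklore] -/
@[simp] theorem unitNormalize_one : unitNormalize (1 : (L⟦X⟧)ˣ) = 1 := by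
  simp [unitNormalize]

/-- **The order-`m` jet** of a unit `f ∈ L⟦X⟧ˣ`: the coefficient of `X^m` in `f/f(0)`. [folklore] -/
def jetCoeff (m : ℕ) (f : (L⟦X⟧)ˣ) : L :=
  coeff m (unitNormalize f)

/-- The order-`0` jet is `1`. [folklore] -/
@[simp] theorem jetCoeff_zero (f : (L⟦X⟧)ˣ) : jetCoeff 0 f = 1 := by
  rw [jetCoeff, coeff_zero_eq_constantCoeff_apply, constantCoeff_unitNormalize]

/-- All positive-order jets of `1` vanish. [folklore] -/
@[simp] theorem jetCoeff_one {m : ℕ} (hm : 0 < m) : jetCoeff m (1 : (L⟦X⟧)ˣ) = 0 := by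
  rw [jetCoeff, unitNormalize_one, coeff_one, if_neg hm.ne']

/-- Product formula at order `m` for series `a ≡ 1 mod X^m`, `b(0) = 1`:
`coeff_m(ab) = coeff_m(a) + coeff_m(b)` (the cross terms vanish). [folklore] -/
theorem coeff_mul_eq_add_of_flat {m : ℕ} (hm : 0 < m) {a b : L⟦X⟧}
    (ha0 : constantCoeff a = 1) (hb0 : constantCoeff b = 1)
    (ha : ∀ k, 0 < k → k < m → coeff k a = 0) :
    coeff m (a * b) = coeff m a + coeff m b := by
  have hm0 : m ≠ 0 := hm.ne'
  rw [coeff_mul, Finset.sum_eq_add_of_mem ((0, m) : ℕ × ℕ) (m, 0)]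
  · simp only [coeff_zero_eq_constantCoeff_apply, ha0, hb0, one_mul, mul_one]
    rw [add_comm]
  · exact Finset.mem_antidiagonal.mpr (zero_add m)
  · exact Finset.mem_antidiagonal.mpr (add_zero m)
  · simp [hm0]
  · rintro ⟨i, j⟩ hij ⟨h₁, h₂⟩
    rw [Finset.mem_antidiagonal] at hij
    have hi0 : i ≠ 0 := by
      rintro rfl
      exact h₁ (by simp_all)
    have him : i < m := by
      rcases lt_or_ge i m with h | h
      · exact h
      · exfalso
        have : j = 0 := by omega
        subst this
        exact h₂ (by simp_all)
    show coeff i a * coeff j b = 0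
    rw [ha i (Nat.pos_of_ne_zero hi0) him, zero_mul]

/-- **Jets are additive to leading order**: if the jets of `f` vanish in orders `0 < k < m` then
`jet_m(fg) = jet_m(f) + jet_m(g)`. [folklore] -/
theorem jetCoeff_mul_of_flat {m : ℕ} (hm : 0 < m) {f : (L⟦X⟧)ˣ} (g : (L⟦X⟧)ˣ)
    (hf : ∀ k, 0 < k → k < m → jetCoeff k f = 0) :
    jetCoeff m (f * g) = jetCoeff m f + jetCoeff m g := by
  simp only [jetCoeff, unitNormalize_mul]
  exact coeff_mul_eq_add_of_flat hm (constantCoeff_unitNormalize f)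
    (constantCoeff_unitNormalize g) hf

variable [TopologicalSpace L] {G : Type*} [Monoid G] [TopologicalSpace G]

/-- The constant-term map on units `L⟦X⟧ˣ → Lˣ` ("specialise the family at `X = 0`"), a
continuous homomorphism for the coefficientwise topology. [folklore] -/
def unitsConstantCoeff : (L⟦X⟧)ˣ →ₜ* Lˣ where
  toMonoidHom := Units.map (constantCoeff : L⟦X⟧ →+* L).toMonoidHom
  continuous_toFun :=
    Continuous.units_map _ (PowerSeries.WithPiTopology.continuous_constantCoeff L)

/-- Unfolding lemma for `unitsConstantCoeff`. [folklore] -/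
@[simp] theorem val_unitsConstantCoeff_apply (f : (L⟦X⟧)ˣ) :
    ((unitsConstantCoeff f : Lˣ) : L) = constantCoeff (f : L⟦X⟧) := rfl

/-- The constant family map on units `Lˣ → L⟦X⟧ˣ`, a continuous homomorphism. [folklore] -/
def unitsC : Lˣ →ₜ* (L⟦X⟧)ˣ where
  toMonoidHom := Units.map (C : L →+* L⟦X⟧).toMonoidHom
  continuous_toFun := Continuous.units_map _ PowerSeries.WithPiTopology.continuous_C

/-- Unfolding lemma for `unitsC`. [folklore] -/
@[simp] theorem val_unitsC_apply (a : Lˣ) : ((unitsC a : (L⟦X⟧)ˣ) : L⟦X⟧) = C (a : L) := rfl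

/-- **Specialisation at `X = 0`** of a one-parameter family of characters
`χ : G → L⟦X⟧ˣ`: the character `g ↦ χ(g)(0)`. [folklore] -/
def specializeAtZero (χ : G →ₜ* (L⟦X⟧)ˣ) : G →ₜ* Lˣ :=
  unitsConstantCoeff.comp χ

/-- Unfolding lemma for `specializeAtZero`. [folklore] -/
@[simp] theorem val_specializeAtZero_apply (χ : G →ₜ* (L⟦X⟧)ˣ) (g : G) :
    ((specializeAtZero χ g : Lˣ) : L) = constantCoeff ((χ g : (L⟦X⟧)ˣ) : L⟦X⟧) := rfl

/-- The **constant family** through a character `χ₀ : G → Lˣ`. [folklore] -/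
def constFamily (χ₀ : G →ₜ* Lˣ) : G →ₜ* (L⟦X⟧)ˣ :=
  unitsC.comp χ₀

/-- Unfolding lemma for `constFamily`. [folklore] -/
@[simp] theorem val_constFamily_apply (χ₀ : G →ₜ* Lˣ) (g : G) :
    ((constFamily χ₀ g : (L⟦X⟧)ˣ) : L⟦X⟧) = C ((χ₀ g : Lˣ) : L) := rfl

/-- The constant family specialises to itself. [folklore] -/
@[simp] theorem specializeAtZero_constFamily (χ₀ : G →ₜ* Lˣ) : specializeAtZero (constFamily χ₀) = χ₀ :=
  ContinuousMonoidHom.ext fun g => Units.ext (by simp)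

/-- **The order-`m` jet of a family of characters** `χ : G → L⟦X⟧ˣ`: the function
`g ↦ coeff_m (χ(g)/χ(g)(0))` on `G` (for `m = 1` and `χ = χ₀(1 + εψ + …)` this is `ψ`).
[folklore] -/
def charJet (χ : G →ₜ* (L⟦X⟧)ˣ) (m : ℕ) (g : G) : L :=
  jetCoeff m (χ g)

/-- The order-`0` jet is identically `1`. [folklore] -/
@[simp] theorem charJet_zero (χ : G →ₜ* (L⟦X⟧)ˣ) (g : G) : charJet χ 0 g = 1 :=
  jetCoeff_zero _

/-- Jets vanish at the identity in every positive order. [folklore] -/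
theorem charJet_one {χ : G →ₜ* (L⟦X⟧)ˣ} {m : ℕ} (hm : 0 < m) : charJet χ m 1 = 0 := by
  rw [charJet, map_one, jetCoeff_one hm]

/-- The normalised series of a constant unit is `1`. [folklore] -/
@[simp] theorem unitNormalize_unitsC (a : Lˣ) : unitNormalize (unitsC a) = 1 := by
  rw [unitNormalize, ← map_inv unitsC a, val_unitsC_apply, val_unitsC_apply, constantCoeff_C,
    ← map_mul, Units.mul_inv, map_one]

/-- The constant family has no jets of positive order. [folklore] -/
theorem charJet_constFamily (χ₀ : G →ₜ* Lˣ) {m : ℕ} (hm : 0 < m) (g : G) :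
    charJet (constFamily χ₀) m g = 0 := by
  have h : unitNormalize (constFamily χ₀ g) = 1 := unitNormalize_unitsC (χ₀ g)
  rw [charJet, jetCoeff, h, coeff_one, if_neg hm.ne']

/-- `χ` is **flat below order `m`**: `χ ≡ χ(0) mod X^m`, i.e. all jets of orders `0 < k < m`
vanish. [folklore] -/
def IsFlatBelow (χ : G →ₜ* (L⟦X⟧)ˣ) (m : ℕ) : Prop :=
  ∀ k, 0 < k → k < m → ∀ g, charJet χ k g = 0

/-- Flatness is monotone in the order. [folklore] -/
theorem IsFlatBelow.mono {χ : G →ₜ* (L⟦X⟧)ˣ} {m m' : ℕ} (h : IsFlatBelow χ m) (hm : m' ≤ m) :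
    IsFlatBelow χ m' :=
  fun k hk hkm g => h k hk (lt_of_lt_of_le hkm hm) g

/-- Every family is flat below order `1`. [folklore] -/
theorem isFlatBelow_one (χ : G →ₜ* (L⟦X⟧)ˣ) : IsFlatBelow χ 1 :=
  fun _ hk hk1 _ => absurd hk1 (not_lt.mpr hk)

/-- **The leading-order jet is an additive character**: if `χ ≡ χ(0) mod X^m` (`m ≥ 1`) then
`jet_m χ (g g') = jet_m χ g + jet_m χ g'` — the first-order deformation `ψ` of
`χ₀(1 + X^m ψ + O(X^{m+1}))` is a homomorphism `G → (L, +)`. [folklore] -/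
theorem charJet_mul {χ : G →ₜ* (L⟦X⟧)ˣ} {m : ℕ} (hm : 0 < m) (h : IsFlatBelow χ m) (g g' : G) :
    charJet χ m (g * g') = charJet χ m g + charJet χ m g' := by
  unfold charJet
  rw [map_mul]
  exact jetCoeff_mul_of_flat hm _ fun k hk hkm => h k hk hkm g

/-- **The leading order** of a family of characters: the least `m ≥ 1` with a non-zero order-`m`
jet (`0` if the family is constant to all orders, `sInf ∅ = 0`). [folklore] -/
def leadingOrder (χ : G →ₜ* (L⟦X⟧)ˣ) : ℕ :=
  sInf {m | 0 < m ∧ ∃ g, charJet χ m g ≠ 0}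

/-- A family is flat below its leading order. [folklore] -/
theorem isFlatBelow_leadingOrder (χ : G →ₜ* (L⟦X⟧)ˣ) : IsFlatBelow χ (leadingOrder χ) := by
  intro k hk hkm g
  by_contra h
  exact Nat.notMem_of_lt_sInf hkm ⟨hk, g, h⟩

/-- If some positive-order jet is non-zero, the leading order is positive and carries a non-zero
jet. [folklore] -/
theorem leadingOrder_spec {χ : G →ₜ* (L⟦X⟧)ˣ} {m : ℕ} (hm : 0 < m) {g : G}
    (hg : charJet χ m g ≠ 0) : 0 < leadingOrder χ ∧ ∃ g', charJet χ (leadingOrder χ) g' ≠ 0 :=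
  Nat.sInf_mem (s := {m | 0 < m ∧ ∃ g, charJet χ m g ≠ 0}) ⟨m, hm, g, hg⟩

/-- The leading order is at most any order carrying a non-zero jet. [folklore] -/
theorem leadingOrder_le {χ : G →ₜ* (L⟦X⟧)ˣ} {m : ℕ} (hm : 0 < m) {g : G}
    (hg : charJet χ m g ≠ 0) : leadingOrder χ ≤ m :=
  Nat.sInf_le ⟨hm, g, hg⟩

/-- **The leading jet** `d/ds|(χ ∘ γ)` of a family of characters: its jet at the leading order
(the zero function for a family constant to all orders). [folklore] -/
def leadingJet (χ : G →ₜ* (L⟦X⟧)ˣ) : G → L :=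
  if leadingOrder χ = 0 then 0 else charJet χ (leadingOrder χ)

/-- The leading jet is an additive character of `G`. [folklore] -/
theorem leadingJet_mul (χ : G →ₜ* (L⟦X⟧)ˣ) (g g' : G) :
    leadingJet χ (g * g') = leadingJet χ g + leadingJet χ g' := by
  unfold leadingJet
  split_ifs with h
  · simp
  · exact charJet_mul (Nat.pos_of_ne_zero h) (isFlatBelow_leadingOrder χ) g g'

/-- The leading jet vanishes at `1`. [folklore] -/
@[simp] theorem leadingJet_one (χ : G →ₜ* (L⟦X⟧)ˣ) : leadingJet χ 1 = 0 := by
  have h := leadingJet_mul χ 1 1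
  rw [one_mul] at h
  simpa using h

/-- The leading jet of the constant family is zero. [folklore] -/
theorem leadingJet_constFamily (χ₀ : G →ₜ* Lˣ) : leadingJet (constFamily χ₀) = 0 := by
  unfold leadingJet
  split_ifs with h
  · rfl
  · funext g
    exact charJet_constFamily χ₀ (Nat.pos_of_ne_zero h) g

/-- Jets are continuous in the group variable (coefficientwise topology on `L⟦X⟧`). [folklore] -/
theorem continuous_charJet [IsTopologicalRing L] (χ : G →ₜ* (L⟦X⟧)ˣ) (m : ℕ) :
    Continuous (charJet χ m) := by
  have h1 : Continuous fun g => ((χ g : (L⟦X⟧)ˣ) : L⟦X⟧) :=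
    Units.continuous_val.comp (map_continuous χ)
  have h2 : Continuous fun g => (((χ g)⁻¹ : (L⟦X⟧)ˣ) : L⟦X⟧) :=
    Units.continuous_coe_inv.comp (map_continuous χ)
  exact (PowerSeries.WithPiTopology.continuous_coeff L m).comp
    (h1.mul (PowerSeries.WithPiTopology.continuous_C.comp
      ((PowerSeries.WithPiTopology.continuous_constantCoeff L).comp h2)))

end Jets

/-! ### Places above `p`: finiteness -/

section Places

variable (K : Type*) [Field K] [NumberField K] (p : ℕ) [Fact p.Prime]

/-- There are finitely many places of `K` above `p` (`Ideal.finite_factors`). [folklore] -/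
theorem finite_setOf_mem_placesOver : {v : HeightOneSpectrum (𝓞 K) | ((p : ℕ) : 𝓞 K) ∈ v.asIdeal}.Finite := by
  have hp : (Ideal.span {((p : ℕ) : 𝓞 K)} : Ideal (𝓞 K)) ≠ 0 := by
    rw [Ne, Ideal.zero_eq_bot, Ideal.span_singleton_eq_bot]
    exact_mod_cast (Fact.out : p.Prime).ne_zero
  refine (Ideal.finite_factors hp).subset fun v hv => ?_
  exact (Ideal.dvd_span_singleton).2 hv

/-- `PlacesOver K p` is finite. [folklore] -/
instance PlacesOver.instFinite : Finite (PlacesOver K p) :=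
  (finite_setOf_mem_placesOver K p).to_subtype

/-- `PlacesOver K p` is a finite type (so that `∏ v : PlacesOver K p` makes sense). [folklore] -/
instance PlacesOver.instFintype : Fintype (PlacesOver K p) :=
  Fintype.ofFinite _

/-- **The normalised valuation `ord` on units** of a field valued in `ℤₘ₀`:
`ord u = -log v(u)`, so that a uniformiser (`v(ϖ) = exp(-1)`) has `ord ϖ = 1`; as an additive
function `K_vˣ → ℤ` it is the direction paired against first-order jets in the
Colmez–Greenberg–Stevens formula ("crystalline iff `ord ∈ c^⊥`"). [folklore] -/
def unitsOrd {F : Type*} [Field F] [Valued F (WithZero (Multiplicative ℤ))] (u : Fˣ) : ℤ :=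
  - WithZero.log (Valued.v (u : F))

/-- `ord` is additive. [folklore] -/
theorem unitsOrd_mul {F : Type*} [Field F] [Valued F (WithZero (Multiplicative ℤ))] (u u' : Fˣ) :
    unitsOrd (u * u') = unitsOrd u + unitsOrd u' := by
  simp only [unitsOrd, Units.val_mul, map_mul]
  rw [WithZero.log_mul ((Valuation.ne_zero_iff _).mpr u.ne_zero)
    ((Valuation.ne_zero_iff _).mpr u'.ne_zero)]
  ring

/-- `ord 1 = 0`. [folklore] -/
@[simp] theorem unitsOrd_one {F : Type*} [Field F] [Valued F (WithZero (Multiplicative ℤ))] :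
    unitsOrd (1 : Fˣ) = 0 := by
  simp [unitsOrd]

variable {K} in
/-- **A uniformiser of `K_v` as a unit**: the image in `K_v` of an element of `K` of valuation
`exp(-1)` (Mathlib `valuation_exists_uniformizer`); available to fill the field `unif`. [folklore] -/
def uniformizerUnit (v : HeightOneSpectrum (𝓞 K)) : (v.adicCompletion K)ˣ :=
  Units.mk0 ((Classical.choose (v.valuation_exists_uniformizer K) : K) : v.adicCompletion K) (by
    intro h
    have h1 := v.valuedAdicCompletion_eq_valuation'
      (Classical.choose (v.valuation_exists_uniformizer K))
    rw [h, map_zero, Classical.choose_spec (v.valuation_exists_uniformizer K)] at h1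
    exact WithZero.coe_ne_zero h1.symm)

variable {K} in
/-- `uniformizerUnit v` is a uniformiser: its valuation is `exp(-1)`. [folklore] -/
theorem valuation_uniformizerUnit (v : HeightOneSpectrum (𝓞 K)) :
    Valued.v ((uniformizerUnit v : (v.adicCompletion K)ˣ) : v.adicCompletion K) =
      WithZero.exp (-1 : ℤ) := by
  rw [uniformizerUnit, Units.val_mk0, HeightOneSpectrum.valuedAdicCompletion_eq_valuation']
  exact Classical.choose_spec (v.valuation_exists_uniformizer K)

variable {K} in
/-- The chosen uniformiser has `ord = 1`. [folklore] -/
@[simp] theorem unitsOrd_uniformizerUnit (v : HeightOneSpectrum (𝓞 K)) :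
    unitsOrd (uniformizerUnit v) = 1 := by
  rw [unitsOrd, valuation_uniformizerUnit, WithZero.log_exp]
  norm_num

end Places

/-! ### The weight side: central values, algebraic and arithmetic weights -/

section Weights

variable {K : Type*} [Field K] [NumberField K] {n p : ℕ} [Fact p.Prime]

/-- The diagonal map `𝒪_Kˣ → 𝒪_{K_v}ˣ` at a finite place (units of `algebraMap`). [folklore] -/
def globalUnitsToLocal (v : HeightOneSpectrum (𝓞 K)) : (𝓞 K)ˣ →* (v.adicCompletionIntegers K)ˣ :=
  Units.map (algebraMap (𝓞 K) (v.adicCompletionIntegers K) : 𝓞 K →+* _).toMonoidHom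

/-- Unfolding lemma for `globalUnitsToLocal`. [folklore] -/
@[simp] theorem val_globalUnitsToLocal_apply (v : HeightOneSpectrum (𝓞 K)) (u : (𝓞 K)ˣ) :
    ((globalUnitsToLocal v u : (v.adicCompletionIntegers K)ˣ) : v.adicCompletionIntegers K) =
      algebraMap (𝓞 K) (v.adicCompletionIntegers K) (u : 𝓞 K) := rfl

variable {L : Type*} [CommMonoid L] [TopologicalSpace L]

/-- **The value of a weight on a central global unit**: `κ(diag(u,…,u)) = ∏_{v∣p} ∏_i κ_{v,i}(u)`
for `u ∈ 𝒪_Kˣ` embedded diagonally in `T(ℤ_p) = ∏_{v∣p} (𝒪_{K_v}ˣ)ⁿ` — the quantity the level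
condition "trivial on the closure of `Z(K^p I)`" constrains (Hansen §2.2, p. 13).
[cite: HansenUniversalEigenvarieties2017, §2.2] -/
def PAdicWeight.centralValue (κ : PAdicWeight K n p L) (u : (𝓞 K)ˣ) : L :=
  ∏ v : PlacesOver K p, ∏ i : Fin n, ((κ v i (globalUnitsToLocal v.1 u) : Lˣ) : L)

/-- `centralValue` is multiplicative in the unit. [folklore] -/
theorem PAdicWeight.centralValue_mul (κ : PAdicWeight K n p L) (u u' : (𝓞 K)ˣ) :
    κ.centralValue (u * u') = κ.centralValue u * κ.centralValue u' := by
  simp only [PAdicWeight.centralValue, map_mul, Units.val_mul, Finset.prod_mul_distrib]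

/-- `centralValue` at `1` is `1`. [folklore] -/
@[simp] theorem PAdicWeight.centralValue_one (κ : PAdicWeight K n p L) : κ.centralValue 1 = 1 := by
  simp [PAdicWeight.centralValue]

/-- A continuous character `χ : 𝒪_{K_v}ˣ → ℚ̄_pˣ` is **algebraic** if `χ(u) = ∏_τ τ(u)^{k_τ}` for
integers `k_τ` indexed by (finitely many) field embeddings `τ : K_v → ℚ̄_p` — an element of
`X^*` in Hansen's `λ = λ^alg ε` (§3.2), a product of labelled algebraic characters.
[cite: HansenUniversalEigenvarieties2017, §3.2 (arithmetic weights)] -/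
def IsAlgebraicCharacter {v : HeightOneSpectrum (𝓞 K)}
    (χ : (v.adicCompletionIntegers K)ˣ →ₜ* (PadicAlgCl p)ˣ) : Prop :=
  ∃ (s : Finset (v.adicCompletion K →+* PadicAlgCl p)) (k : (v.adicCompletion K →+* PadicAlgCl p) → ℤ),
    ∀ u : (v.adicCompletionIntegers K)ˣ, ((χ u : (PadicAlgCl p)ˣ) : PadicAlgCl p) =
      ∏ τ ∈ s, τ ((u : v.adicCompletionIntegers K) : v.adicCompletion K) ^ k τ

/-- A continuous character has **finite order** if `χ^N = 1` for some `N ≥ 1`. [folklore] -/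
def HasFiniteOrder {G M : Type*} [Monoid G] [TopologicalSpace G] [Monoid M] [TopologicalSpace M]
    (χ : G →ₜ* M) : Prop :=
  ∃ N : ℕ, 0 < N ∧ ∀ g, χ g ^ N = 1

/-- A `p`-adic weight `κ = (κ_{v,i})` is **arithmetic** if every `κ_{v,i}` is the product of an
algebraic character and a finite-order character (Hansen §3.2: "`λ` is arithmetic if it factors
as the product of a finite-order character `ε` of `T(ℤ_p)` and an element `λ^alg` of `X^*`").
Dominance of `λ^alg` is not imposed here. [cite: HansenUniversalEigenvarieties2017, §3.2] -/
def PAdicWeight.IsArithmetic (κ : PAdicWeight K n p (PadicAlgCl p)) : Prop :=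
  ∀ (v : PlacesOver K p) (i : Fin n),
    ∃ χa χf : (v.1.adicCompletionIntegers K)ˣ →ₜ* (PadicAlgCl p)ˣ,
      IsAlgebraicCharacter χa ∧ HasFiniteOrder χf ∧ ∀ u, κ v i u = χa u * χf u

end Weights

/-! ### Exponents of Jacquet modules (accessible refinements) -/

section Jacquet

variable {F : Type*} [Field F] {n : ℕ}

/-- A diagonal torus element `t = (t₁,…,tₙ)` viewed in the Levi `∏ₐ GL₁` of the Borel `P_id`
(block labelling `c = id`, all blocks of size one) of the tree's `Representation.jacquetGL`.
[folklore] -/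
def borelLeviOfTorus (t : Fin n → Fˣ) : (a : Fin n) → GL {i : Fin n // id i = a} F :=
  fun a => Units.map (Matrix.scalar {i : Fin n // id i = a} : F →+* _).toMonoidHom (t a)

/-- Unfolding lemma for `borelLeviOfTorus` (each block is the scalar `t a`). [folklore] -/
@[simp] theorem val_borelLeviOfTorus_apply (t : Fin n → Fˣ) (a : Fin n) :
    ((borelLeviOfTorus t a : GL {i : Fin n // id i = a} F) : Matrix _ _ F) =
      Matrix.scalar {i : Fin n // id i = a} ((t a : Fˣ) : F) := rfl

variable [TopologicalSpace F]

/-- **`χ` is an exponent of the Jacquet module of `π`** (with respect to the upper-triangular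
Borel): there is a non-zero vector `w` in the (unnormalised) Jacquet module `π_N` (the tree's
`Representation.jacquetGL F id π.ρ`, coinvariants under the unipotent radical) on which the
diagonal torus `T(F) = (Fˣ)ⁿ` acts through the character `χ`.  For `π` unramified,
Bellaïche–Chenevier define a refinement `𝓡 ↔ χ_𝓡 : T/T⁰ → ℂˣ` to be **accessible** iff
`χ_𝓡 δ_B^{1/2}` occurs in `π_N^{T⁰}`, i.e. iff `χ_𝓡 δ_B^{1/2}` is an exponent in the present sense
(Def. 6.4.6; all refinements are accessible when `π` is an irreducible unramified principal
series, Prop. 6.4.7); the eigenvariety sees `π_p` exactly through these characters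
(`ψ_p|_U = χ δ_B^{-1/2} δ_κ`, loc. cit. (7.2.2); Hansen Prop. 5.2.1).
[cite: BellaicheChenevier2009, Def. 6.4.5, Def. 6.4.6, Prop. 6.4.7] [cite: HansenUniversalEigenvarieties2017, Prop. 5.2.1] -/
def IsJacquetExponent (π : SmoothIrrep (GL (Fin n) F)) (χ : (Fin n → Fˣ) →* ℂˣ) : Prop :=
  ∃ w : (Representation.restrictUnipotentGL F (id : Fin n → Fin n) π.ρ).Coinvariants, w ≠ 0 ∧
    ∀ t : Fin n → Fˣ,
      Representation.jacquetGL F (id : Fin n → Fin n) π.ρ (borelLeviOfTorus t) w =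
        ((χ t : ℂˣ) : ℂ) • w

/-- Unfolding lemma for `IsJacquetExponent`. [folklore] -/
theorem isJacquetExponent_iff (π : SmoothIrrep (GL (Fin n) F)) (χ : (Fin n → Fˣ) →* ℂˣ) :
    IsJacquetExponent π χ ↔
      ∃ w : (Representation.restrictUnipotentGL F (id : Fin n → Fin n) π.ρ).Coinvariants, w ≠ 0 ∧
        ∀ t : Fin n → Fˣ,
          Representation.jacquetGL F (id : Fin n → Fin n) π.ρ (borelLeviOfTorus t) w =
            ((χ t : ℂˣ) : ℂ) • w :=
  Iff.rfl

end Jacquet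

/-! ### The datum -/

/-- The type of **refinement exponents** at the places above `p`: for each `v ∣ p` a character of
the diagonal torus `T(K_v) = (K_vˣ)ⁿ` (intended: an exponent of the Jacquet module of `π_v`,
`IsJacquetExponent`; for unramified `π_v`, `χ_v = χ_𝓡 δ_B^{1/2}` for an accessible refinement `𝓡`,
Bellaïche–Chenevier Def. 6.4.6). [cite: BellaicheChenevier2009, Def. 6.4.6 and Def. 7.2.1] -/
abbrev RefinementExponent (K : Type*) [Field K] [NumberField K] (n p : ℕ) : Type _ :=
  ∀ v : PlacesOver K p, (Fin n → (v.1.adicCompletion K)ˣ) →* ℂˣ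

/-- An **eigenvariety datum for `Res_{K/ℚ} GL_n` at `p` with bad places `S`, with its ring of
functions**: the points-level datum `Eigenvariety K n p S` (points `Pt = 𝒳(ℚ̄_p)` with the Zariski
topology, eigenvalues `φ_x(T_{v,i})`, parameters `δ_x`, Galois representations `ρ_x`, degrees,
classical points) EXTENDED by

* `unif v = ϖ_v`, the uniformisers at `v ∣ p` entering `𝒜_p^+`, the `U_{v,i}` and `δ_𝒳` (Hansen
  §1.1, §2);
* `noncritical`, `interior`, `regular ⊆ classical` (Hansen Def. 3.2.3; "regular" = the algebraic
  part of the weight is regular, §1.1);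
* `Fn = 𝒪(𝒳^red)`, a topological ring, with the evaluations `eval x : Fn →+* ℚ̄_p` at points
  (continuous, jointly injective: `𝒳^red` is reduced and its rigid points are Zariski dense), such
  that zero loci of functions are Zariski closed (`isClosed_zeroLocus`);
* `heckeFn v i = φ_𝒳(T_{v,i}) ∈ Fn` (`v ∉ S`, `1 ≤ i ≤ n`, `T_{v,0} = 1`), `paramFn = δ_𝒳`, the global
  character of `T(ℚ_p) = ∏_{v∣p}(K_vˣ)ⁿ` (Hansen §1.2: "there is a unique global character
  `δ_𝒳 : T(ℚ_p) → 𝒪(𝒳_{K^p})ˣ` specializing to `δ_x` at every point `x`"), and `traceFn`, the trace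
  of the Johansson–Newton determinant `D : Γ_K → 𝒪⁺(𝒳^red)` (a continuous `n`-dimensional
  pseudocharacter), with their specialisations `eval_heckeFn`, `eval_paramFn`, `eval_traceFn` to
  the point data;
* the refined-classical-point relation `IsClassicalPointOf ι x π χ` (Bellaïche–Chenevier's
  `(π, 𝓡) ↦ z ∈ Z`, Def. 7.2.1–7.2.3, for CUSPIDAL `π`; Hansen Def. 3.2.3) and its axioms, see the
  module docstring;
* `isArithmetic_weight`: classical points have arithmetic weight (Hansen §3.2, Def. 3.2.3).

No existence statement and no theorem about the constructions is a field; those are the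
predicates `HasDiscreteWeightFibres`, `HasFiniteSlopeFibres`, `HasClassicalDefect`,
`HasWeightsOfLevel`, `HasRefinedClassicalPoints` below and the inherited ones of `Eigenvariety`.
Conventions: `param`/`paramFn` is Hansen's `δ` (§1.2 (i)–(ii)), so `weight = δ|_{T(ℤ_p)}` as in
`Eigenvariety`. [cite: HansenUniversalEigenvarieties2017, Thm. 1.1.2, §1.2, Def. 3.2.3, Def. 4.3.2, Thm. 4.3.3]
[cite: JohanssonNewton2019, Thm. B] [cite: BellaicheChenevier2009, Def. 7.2.1–7.2.3, Def. 7.2.5, Rem. 7.2.4, Lemma 7.2.8] -/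
structure EigenvarietyResGLn (K : Type) [Field K] [NumberField K] (n p : ℕ) [Fact p.Prime]
    (S : Set (HeightOneSpectrum (𝓞 K))) extends Eigenvariety K n p S where
  /-- The chosen uniformisers `ϖ_v ∈ K_vˣ`, `v ∣ p`. -/
  unif : ∀ v : PlacesOver K p, (v.1.adicCompletion K)ˣ
  /-- `ϖ_v` is a uniformiser: `v(ϖ_v) = exp(-1)`. -/
  valuation_unif : ∀ v : PlacesOver K p,
    Valued.v ((unif v : (v.1.adicCompletion K)ˣ) : v.1.adicCompletion K) = WithZero.exp (-1 : ℤ)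
  /-- The non-critical classical points (Hansen Def. 3.2.3). -/
  noncritical : Set Pt
  /-- The interior classical points (Hansen Def. 3.2.3). -/
  interior : Set Pt
  /-- The classical points whose weight has regular algebraic part (Hansen §1.1). -/
  regular : Set Pt
  noncritical_subset : noncritical ⊆ classical
  interior_subset : interior ⊆ classical
  regular_subset : regular ⊆ classical
  /-- Classical points have arithmetic weight `λ = λ^alg ε`. -/
  isArithmetic_weight : ∀ x ∈ classical, (TorusCharacter.restrict (param x)).IsArithmetic
  /-- The ring of global functions `𝒪(𝒳^red)`. -/
  Fn : Type
  [instCommRing : CommRing Fn]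
  [instTopologicalSpace : TopologicalSpace Fn]
  [instIsTopologicalRing : IsTopologicalRing Fn]
  /-- Evaluation of functions at the point `x` (into `k(x) ⊆ ℚ̄_p`). -/
  eval : Pt → (Fn →+* PadicAlgCl p)
  continuous_eval : ∀ x, Continuous (eval x)
  /-- `𝒳^red` is reduced with dense rigid points: a function vanishing at every point is `0`. -/
  eval_injective : ∀ f g : Fn, (∀ x, eval x f = eval x g) → f = g
  /-- Zero loci of global functions are Zariski closed. -/
  isClosed_zeroLocus : ∀ f : Fn, @IsClosed Pt topology {x | eval x f = 0}
  /-- `heckeFn v i = φ_𝒳(T_{v,i})` (`v ∉ S`, `1 ≤ i ≤ n`; other values unused). -/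
  heckeFn : HeightOneSpectrum (𝓞 K) → ℕ → Fn
  /-- Normalisation `T_{v,0} = 1`. -/
  heckeFn_zero : ∀ v, heckeFn v 0 = 1
  eval_heckeFn : ∀ x v i, eval x (heckeFn v i) = heckeEigenvalue x v i
  /-- The universal character `δ_𝒳 : T(ℚ_p) → 𝒪(𝒳)ˣ`. -/
  paramFn : TorusCharacter K n p Fn
  eval_paramFn : ∀ (x : Pt) (v : PlacesOver K p) (i : Fin n) (u : (v.1.adicCompletion K)ˣ),
    eval x ((paramFn v i u : Fnˣ) : Fn) = ((param x v i u : (PadicAlgCl p)ˣ) : PadicAlgCl p)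
  /-- The trace of the Galois determinant over `𝒳^red` (Johansson–Newton Thm. B). -/
  traceFn : GaloisRepresentations.ContinuousPseudocharacter (absoluteGaloisGroup K) Fn n
  eval_traceFn : ∀ (x : Pt) (σ : absoluteGaloisGroup K),
    eval x (traceFn σ) = GaloisRepresentations.FramedRep.trace (galoisRep x) σ
  /-- `x` is the classical point attached through `ι` to the cuspidal `π` refined by `χ`. -/
  IsClassicalPointOf : ∀ {hcpt : isCompact_glFiniteIntegralLevel n K},
    (PadicAlgCl p ≃+* ℂ) → Pt → CuspidalAutomorphicRepData n K hcpt → RefinementExponent K n p → Prop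
  mem_classical_of_isClassicalPointOf : ∀ {hcpt : isCompact_glFiniteIntegralLevel n K}
    {ι : PadicAlgCl p ≃+* ℂ} {x : Pt} {π : CuspidalAutomorphicRepData n K hcpt}
    {χ : RefinementExponent K n p}, IsClassicalPointOf ι x π χ → x ∈ classical
  /-- The attached `π` is regular algebraic (cuspidal cohomological; Hansen Prop. 3.2.1, Clozel). -/
  isRegularAlgebraic_of_isClassicalPointOf : ∀ {hcpt : isCompact_glFiniteIntegralLevel n K}
    {ι : PadicAlgCl p ≃+* ℂ} {x : Pt} {π : CuspidalAutomorphicRepData n K hcpt}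
    {χ : RefinementExponent K n p}, IsClassicalPointOf ι x π χ → π.1.IsRegularAlgebraic
  /-- `φ_x` matches the Hecke data of `π` away from `S` (Hansen §1.1, Def. 1.2.1). -/
  hasHeckePolynomialAt_of_isClassicalPointOf : ∀ {hcpt : isCompact_glFiniteIntegralLevel n K}
    {ι : PadicAlgCl p ≃+* ℂ} {x : Pt} {π : CuspidalAutomorphicRepData n K hcpt}
    {χ : RefinementExponent K n p}, IsClassicalPointOf ι x π χ →
      ∀ v : HeightOneSpectrum (𝓞 K), v ∉ S →
        π.1.HasHeckePolynomialAt v ((heckeFrobPoly v.residueCard n (heckeEigenvalue x v)).map ι.toRingHom)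
  /-- Each `χ_v` is an exponent of the Jacquet module of a local component of `π` at `v ∣ p`. -/
  isJacquetExponent_of_isClassicalPointOf : ∀ {hcpt : isCompact_glFiniteIntegralLevel n K}
    {ι : PadicAlgCl p ≃+* ℂ} {x : Pt} {π : CuspidalAutomorphicRepData n K hcpt}
    {χ : RefinementExponent K n p}, IsClassicalPointOf ι x π χ →
      ∀ v : PlacesOver K p, ∃ πv : SmoothIrrep (GL (Fin n) (v.1.adicCompletion K)),
        π.1.HasLocalComponentAt v.1 πv.ρ ∧ IsJacquetExponent πv (χ v)
  /-- `(π, χ)` has at most one point (Hansen Thm. 4.3.3; Bellaïche–Chenevier Lemma 7.2.8 (c)). -/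
  eq_of_isClassicalPointOf : ∀ {hcpt : isCompact_glFiniteIntegralLevel n K}
    {ι : PadicAlgCl p ≃+* ℂ} {x y : Pt} {π : CuspidalAutomorphicRepData n K hcpt}
    {χ : RefinementExponent K n p}, IsClassicalPointOf ι x π χ → IsClassicalPointOf ι y π χ → x = y
  /-- The point determines the refinement (Bellaïche–Chenevier Rem. 7.2.4). -/
  exponent_eq_of_isClassicalPointOf : ∀ {hcpt : isCompact_glFiniteIntegralLevel n K}
    {ι : PadicAlgCl p ≃+* ℂ} {x : Pt} {π : CuspidalAutomorphicRepData n K hcpt}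
    {χ χ' : RefinementExponent K n p},
      IsClassicalPointOf ι x π χ → IsClassicalPointOf ι x π χ' → χ = χ'

attribute [instance] EigenvarietyResGLn.instCommRing EigenvarietyResGLn.instTopologicalSpace
  EigenvarietyResGLn.instIsTopologicalRing

namespace EigenvarietyResGLn

variable {K : Type} [Field K] [NumberField K] {n p : ℕ} [Fact p.Prime]
  {S : Set (HeightOneSpectrum (𝓞 K))} (E : EigenvarietyResGLn K n p S)

/-! #### Functions and points -/

/-- A global function is determined by its values at the points (structure field, restated).
[cite: JohanssonNewton2019, proof of Thm. 5.4.5 (injection into `∏_𝔪 𝒪/𝔪`)] -/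
theorem eval_ext {f g : E.Fn} (h : ∀ x, E.eval x f = E.eval x g) : f = g :=
  E.eval_injective f g h

/-- The joint evaluation map `Fn → (Pt → ℚ̄_p)` is an injective ring homomorphism. [folklore] -/
def evalAll : E.Fn →+* (E.Pt → PadicAlgCl p) where
  toFun f x := E.eval x f
  map_one' := funext fun x => map_one (E.eval x)
  map_mul' f g := funext fun x => map_mul (E.eval x) f g
  map_zero' := funext fun x => map_zero (E.eval x)
  map_add' f g := funext fun x => map_add (E.eval x) f g

/-- Unfolding lemma for `evalAll`. [folklore] -/
@[simp] theorem evalAll_apply (f : E.Fn) (x : E.Pt) : E.evalAll f x = E.eval x f := rfl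

/-- `evalAll` is injective (reducedness). [folklore] -/
theorem evalAll_injective : Function.Injective E.evalAll :=
  fun _ _ h => E.eval_ext fun x => congrFun h x

/-- The zero locus `V(f) ⊆ Pt` of a global function. [folklore] -/
def zeroLocus (f : E.Fn) : Set E.Pt :=
  {x | E.eval x f = 0}

/-- Membership in the zero locus. [folklore] -/
@[simp] theorem mem_zeroLocus_iff (f : E.Fn) (x : E.Pt) : x ∈ E.zeroLocus f ↔ E.eval x f = 0 :=
  Iff.rfl

/-- Zero loci are Zariski closed (structure field, restated). [folklore] -/
theorem isClosed_zeroLocus' (f : E.Fn) : IsClosed (E.zeroLocus f) :=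
  E.isClosed_zeroLocus f

/-- The chosen uniformisers have `ord = 1`. [folklore] -/
@[simp] theorem unitsOrd_unif (v : PlacesOver K p) : unitsOrd (E.unif v) = 1 := by
  rw [unitsOrd, E.valuation_unif, WithZero.log_exp]
  norm_num

/-! #### The `U`-part of the parameter: refinements and `U_{v,i}`-eigenvalues -/

/-- **The refinement carried by a point**: `refinement x v i = δ_{x,v,i}(ϖ_v)`, the value of the
`i`-th component of the parameter at the chosen uniformiser — the `U`-part of `δ_x`, i.e.
`φ_x(u_{v,i}) = φ_x(U_{v,i})/φ_x(U_{v,i-1})` (Hansen §1.2 (i), §4.6).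
[cite: HansenUniversalEigenvarieties2017, §1.2 (i) and §4.6] -/
def refinement (x : E.Pt) (v : PlacesOver K p) (i : Fin n) : PadicAlgCl p :=
  ((E.param x v i (E.unif v) : (PadicAlgCl p)ˣ) : PadicAlgCl p)

/-- The refinement values are non-zero (values of a character). [folklore] -/
theorem refinement_ne_zero (x : E.Pt) (v : PlacesOver K p) (i : Fin n) : E.refinement x v i ≠ 0 :=
  (E.param x v i (E.unif v)).ne_zero

/-- **The `U_{v,i}`-eigenvalue** `φ_x(U_{v,i}) = δ_x(ϖ_v,…,ϖ_v,1,…,1) = ∏_{j < i} δ_{x,v,j}(ϖ_v)`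
(`i` leading entries `ϖ_v`; Hansen §1.2 (i)); `uEigenvalue x v 0 = 1`.
[cite: HansenUniversalEigenvarieties2017, §1.2 (i)] -/
def uEigenvalue (x : E.Pt) (v : PlacesOver K p) (i : ℕ) : PadicAlgCl p :=
  ∏ j ∈ Finset.univ.filter (fun j : Fin n => j.val < i), E.refinement x v j

/-- `U_{v,0} = 1`. [folklore] -/
@[simp] theorem uEigenvalue_zero (x : E.Pt) (v : PlacesOver K p) : E.uEigenvalue x v 0 = 1 := by
  simp [uEigenvalue]

/-- The `U_{v,i}`-eigenvalues are non-zero ("finite slope"). [folklore] -/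
theorem uEigenvalue_ne_zero (x : E.Pt) (v : PlacesOver K p) (i : ℕ) : E.uEigenvalue x v i ≠ 0 :=
  Finset.prod_ne_zero_iff.mpr fun j _ => E.refinement_ne_zero x v j

/-- **The eigenvalue of the canonical controlling operator** `U_p = ∏_{v∣p} ∏_{i=1}^{n-1} U_{v,i}`
(Hansen §4.6) at `x`; its valuation is the slope of `x`. [cite: HansenUniversalEigenvarieties2017, §4.6] -/
def controllingEigenvalue (x : E.Pt) : PadicAlgCl p :=
  ∏ v : PlacesOver K p, ∏ i ∈ Finset.Ico 1 n, E.uEigenvalue x v i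

/-- The controlling eigenvalue is non-zero. [folklore] -/
theorem controllingEigenvalue_ne_zero (x : E.Pt) : E.controllingEigenvalue x ≠ 0 :=
  Finset.prod_ne_zero_iff.mpr fun v _ => Finset.prod_ne_zero_iff.mpr fun i _ =>
    E.uEigenvalue_ne_zero x v i

/-! #### Refined classical points -/

/-- A refined classical point matches its cuspidal representation away from `S`
(`Eigenvariety.MatchesCuspidal`). [cite: HansenUniversalEigenvarieties2017, §1.1 and Def. 1.2.1] -/
theorem matchesCuspidal_of_isClassicalPointOf {hcpt : isCompact_glFiniteIntegralLevel n K}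
    {ι : PadicAlgCl p ≃+* ℂ} {x : E.Pt} {π : CuspidalAutomorphicRepData n K hcpt}
    {χ : RefinementExponent K n p} (h : E.IsClassicalPointOf ι x π χ) :
    E.toEigenvariety.MatchesCuspidal ι x π :=
  ⟨E.isRegularAlgebraic_of_isClassicalPointOf h, E.hasHeckePolynomialAt_of_isClassicalPointOf h⟩

/-- A refined classical point is classical. [cite: HansenUniversalEigenvarieties2017, Def. 3.2.3] -/
theorem mem_classical_of_isClassicalPointOf' {hcpt : isCompact_glFiniteIntegralLevel n K}
    {ι : PadicAlgCl p ≃+* ℂ} {x : E.Pt} {π : CuspidalAutomorphicRepData n K hcpt}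
    {χ : RefinementExponent K n p} (h : E.IsClassicalPointOf ι x π χ) : x ∈ E.classical :=
  E.mem_classical_of_isClassicalPointOf h

/-- A refined classical point has arithmetic weight. [cite: HansenUniversalEigenvarieties2017, §3.2] -/
theorem isArithmetic_weight_of_isClassicalPointOf {hcpt : isCompact_glFiniteIntegralLevel n K}
    {ι : PadicAlgCl p ≃+* ℂ} {x : E.Pt} {π : CuspidalAutomorphicRepData n K hcpt}
    {χ : RefinementExponent K n p} (h : E.IsClassicalPointOf ι x π χ) :
    (E.weight x).IsArithmetic :=
  E.isArithmetic_weight x (E.mem_classical_of_isClassicalPointOf h)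

/-- **The set of refined classical points** of `E` (the `Z` of Bellaïche–Chenevier Def. 7.2.5, for
cuspidal `π`), through `ι`. [cite: BellaicheChenevier2009, Def. 7.2.5] -/
def refinedClassical (hcpt : isCompact_glFiniteIntegralLevel n K) (ι : PadicAlgCl p ≃+* ℂ) :
    Set E.Pt :=
  {x | ∃ (π : CuspidalAutomorphicRepData n K hcpt) (χ : RefinementExponent K n p),
    E.IsClassicalPointOf ι x π χ}

/-- Refined classical points are classical. [folklore] -/
theorem refinedClassical_subset_classical (hcpt : isCompact_glFiniteIntegralLevel n K)
    (ι : PadicAlgCl p ≃+* ℂ) : E.refinedClassical hcpt ι ⊆ E.classical :=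
  fun _ ⟨_, _, h⟩ => E.mem_classical_of_isClassicalPointOf h

/-! #### Arcs through a point and the families along them -/

/-- **The (formal) arcs through `x`**: continuous ring homomorphisms `γ : 𝒪(𝒳^red) → ℚ̄_p⟦X⟧`
(coefficientwise topology) whose constant term is evaluation at `x` — `γ(f) = f(x) + O(X)`.
Every analytic arc `(𝔻, 0) → (𝒳, x)` is one (restriction `𝒪(𝒳) → 𝒪(𝔻) ↪ ℚ̄_p⟦X⟧`), and by
continuity every element factors through the completed local ring at `x`. [folklore] -/
def arcs (x : E.Pt) : Set (E.Fn →+* (PadicAlgCl p)⟦X⟧) :=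
  {γ | Continuous γ ∧ ∀ f, constantCoeff (γ f) = E.eval x f}

/-- Membership in `arcs x`. [folklore] -/
theorem mem_arcs_iff (x : E.Pt) (γ : E.Fn →+* (PadicAlgCl p)⟦X⟧) :
    γ ∈ E.arcs x ↔ Continuous γ ∧ ∀ f, constantCoeff (γ f) = E.eval x f :=
  Iff.rfl

/-- **The constant arc** at `x`: `f ↦ f(x)` as a constant power series. [folklore] -/
def constArc (x : E.Pt) : E.Fn →+* (PadicAlgCl p)⟦X⟧ :=
  (C : PadicAlgCl p →+* (PadicAlgCl p)⟦X⟧).comp (E.eval x)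

/-- Unfolding lemma for `constArc`. [folklore] -/
@[simp] theorem constArc_apply (x : E.Pt) (f : E.Fn) : E.constArc x f = C (E.eval x f) := rfl

/-- The constant arc is an arc through `x`. [folklore] -/
theorem constArc_mem_arcs (x : E.Pt) : E.constArc x ∈ E.arcs x :=
  ⟨PowerSeries.WithPiTopology.continuous_C.comp (E.continuous_eval x),
    fun f => by rw [constArc_apply, constantCoeff_C]⟩

/-- There are arcs through every point. [folklore] -/
theorem arcs_nonempty (x : E.Pt) : (E.arcs x).Nonempty :=
  ⟨E.constArc x, E.constArc_mem_arcs x⟩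

/-- The map on units induced by a continuous arc, as a continuous homomorphism. [folklore] -/
def unitsMapOfArc (γ : E.Fn →+* (PadicAlgCl p)⟦X⟧) (hγ : Continuous γ) :
    E.Fnˣ →ₜ* ((PadicAlgCl p)⟦X⟧)ˣ where
  toMonoidHom := Units.map γ.toMonoidHom
  continuous_toFun := Continuous.units_map _ hγ

/-- Unfolding lemma for `unitsMapOfArc`. [folklore] -/
@[simp] theorem val_unitsMapOfArc_apply (γ : E.Fn →+* (PadicAlgCl p)⟦X⟧) (hγ : Continuous γ)
    (u : E.Fnˣ) : ((E.unitsMapOfArc γ hγ u : ((PadicAlgCl p)⟦X⟧)ˣ) : (PadicAlgCl p)⟦X⟧) = γ (u : E.Fn) :=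
  rfl

/-- **The parameter along an arc**: `δ_𝒳` pushed along `γ`, an `n`-tuple for each `v ∣ p` of
continuous characters `K_vˣ → ℚ̄_p⟦X⟧ˣ` (a one-parameter family of parameters through `δ_x`).
[cite: HansenUniversalEigenvarieties2017, §1.2 (`δ_𝒳`)] -/
def arcParam (γ : E.Fn →+* (PadicAlgCl p)⟦X⟧) (hγ : Continuous γ) :
    TorusCharacter K n p (PadicAlgCl p)⟦X⟧ :=
  fun v i => (E.unitsMapOfArc γ hγ).comp (E.paramFn v i)

/-- Unfolding lemma for `arcParam`. [folklore] -/
@[simp] theorem val_arcParam_apply (γ : E.Fn →+* (PadicAlgCl p)⟦X⟧) (hγ : Continuous γ)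
    (v : PlacesOver K p) (i : Fin n) (u : (v.1.adicCompletion K)ˣ) :
    ((E.arcParam γ hγ v i u : ((PadicAlgCl p)⟦X⟧)ˣ) : (PadicAlgCl p)⟦X⟧) =
      γ ((E.paramFn v i u : E.Fnˣ) : E.Fn) := rfl

/-- **The parameter along an arc through `x` specialises to `δ_x`** at `X = 0`.
[cite: HansenUniversalEigenvarieties2017, §1.2] -/
theorem specializeAtZero_arcParam {x : E.Pt} {γ : E.Fn →+* (PadicAlgCl p)⟦X⟧} (hγ : γ ∈ E.arcs x)
    (v : PlacesOver K p) (i : Fin n) : specializeAtZero (E.arcParam γ hγ.1 v i) = E.param x v i :=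
  ContinuousMonoidHom.ext fun u => Units.ext (by
    rw [val_specializeAtZero_apply, val_arcParam_apply, hγ.2, E.eval_paramFn])

/-- Along an arc through `x`, the parameter at the uniformiser specialises to the refinement of
`x`: `δ_{v,i}(γ)(ϖ_v)(0) = refinement x v i`. [folklore] -/
theorem constantCoeff_arcParam_unif {x : E.Pt} {γ : E.Fn →+* (PadicAlgCl p)⟦X⟧} (hγ : γ ∈ E.arcs x)
    (v : PlacesOver K p) (i : Fin n) :
    constantCoeff ((E.arcParam γ hγ.1 v i (E.unif v) : ((PadicAlgCl p)⟦X⟧)ˣ) : (PadicAlgCl p)⟦X⟧) =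
      E.refinement x v i := by
  rw [val_arcParam_apply, hγ.2, E.eval_paramFn]
  rfl

/-- **The weight along an arc** (`κ ∘ γ`): restriction of the parameter along `γ` to
`T(ℤ_p) = ∏_{v∣p}(𝒪_{K_v}ˣ)ⁿ` (same convention as `Eigenvariety.weight`). [folklore] -/
def arcWeight (γ : E.Fn →+* (PadicAlgCl p)⟦X⟧) (hγ : Continuous γ) :
    PAdicWeight K n p (PadicAlgCl p)⟦X⟧ :=
  (E.arcParam γ hγ).restrict

/-- The weight along an arc through `x` specialises to the weight of `x`. [folklore] -/
theorem specializeAtZero_arcWeight {x : E.Pt} {γ : E.Fn →+* (PadicAlgCl p)⟦X⟧} (hγ : γ ∈ E.arcs x)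
    (v : PlacesOver K p) (i : Fin n) : specializeAtZero (E.arcWeight γ hγ.1 v i) = E.weight x v i :=
  ContinuousMonoidHom.ext fun u => Units.ext (by
    change constantCoeff (γ ((E.paramFn v i (integerUnitsToUnits v.1 u) : E.Fnˣ) : E.Fn)) = _
    rw [hγ.2, E.eval_paramFn]
    rfl)

/-- **The Hecke eigenvalues along an arc**: `γ(φ_𝒳(T_{v,i}))`. [folklore] -/
def arcHecke (γ : E.Fn →+* (PadicAlgCl p)⟦X⟧) (v : HeightOneSpectrum (𝓞 K)) (i : ℕ) :
    (PadicAlgCl p)⟦X⟧ :=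
  γ (E.heckeFn v i)

/-- `T_{v,0} = 1` along arcs. [folklore] -/
@[simp] theorem arcHecke_zero (γ : E.Fn →+* (PadicAlgCl p)⟦X⟧) (v : HeightOneSpectrum (𝓞 K)) :
    E.arcHecke γ v 0 = 1 := by
  rw [arcHecke, E.heckeFn_zero, map_one]

/-- The Hecke eigenvalues along an arc through `x` specialise to those of `x`. [folklore] -/
theorem constantCoeff_arcHecke {x : E.Pt} {γ : E.Fn →+* (PadicAlgCl p)⟦X⟧} (hγ : γ ∈ E.arcs x)
    (v : HeightOneSpectrum (𝓞 K)) (i : ℕ) :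
    constantCoeff (E.arcHecke γ v i) = E.heckeEigenvalue x v i := by
  rw [arcHecke, hγ.2, E.eval_heckeFn]

/-- **The Hecke–Frobenius polynomial along an arc** (`det(X − ρ(Frob_v))` in the family,
`heckeFrobPoly` with coefficients in `ℚ̄_p⟦X⟧`). [cite: HansenUniversalEigenvarieties2017, Def. 1.2.1] -/
def arcFrobPoly (γ : E.Fn →+* (PadicAlgCl p)⟦X⟧) (v : HeightOneSpectrum (𝓞 K)) :
    Polynomial (PadicAlgCl p)⟦X⟧ :=
  heckeFrobPoly v.residueCard n (E.arcHecke γ v)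

/-- The Hecke–Frobenius polynomial along an arc through `x` specialises to `E.frobPoly x v`.
[folklore] -/
theorem map_constantCoeff_arcFrobPoly {x : E.Pt} {γ : E.Fn →+* (PadicAlgCl p)⟦X⟧}
    (hγ : γ ∈ E.arcs x) (v : HeightOneSpectrum (𝓞 K)) :
    (E.arcFrobPoly γ v).map (constantCoeff : (PadicAlgCl p)⟦X⟧ →+* PadicAlgCl p) =
      E.frobPoly x v := by
  rw [arcFrobPoly, heckeFrobPoly_map]
  unfold Eigenvariety.frobPoly
  congr 1
  funext i
  exact E.constantCoeff_arcHecke hγ v i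

/-- **The Galois pseudocharacter along an arc**: the Johansson–Newton determinant pushed along
`γ`, a continuous `n`-dimensional pseudocharacter `Γ_K → ℚ̄_p⟦X⟧` (to be base-changed to
`ℚ̄_p[X]/X^{m+1}` for first-order / Artinian arguments). [cite: JohanssonNewton2019, Thm. B] -/
def arcTrace (γ : E.Fn →+* (PadicAlgCl p)⟦X⟧) (hγ : Continuous γ) :
    GaloisRepresentations.ContinuousPseudocharacter (absoluteGaloisGroup K) (PadicAlgCl p)⟦X⟧ n :=
  E.traceFn.map γ hγ

/-- Unfolding lemma for `arcTrace`. [folklore] -/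
@[simp] theorem arcTrace_apply (γ : E.Fn →+* (PadicAlgCl p)⟦X⟧) (hγ : Continuous γ)
    (σ : absoluteGaloisGroup K) : E.arcTrace γ hγ σ = γ (E.traceFn σ) := rfl

/-- The Galois pseudocharacter along an arc through `x` specialises to `tr ρ_x`. [folklore] -/
theorem constantCoeff_arcTrace {x : E.Pt} {γ : E.Fn →+* (PadicAlgCl p)⟦X⟧} (hγ : γ ∈ E.arcs x)
    (σ : absoluteGaloisGroup K) :
    constantCoeff (E.arcTrace γ hγ.1 σ) = GaloisRepresentations.FramedRep.trace (E.galoisRep x) σ := by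
  rw [arcTrace_apply, hγ.2, E.eval_traceFn]

/-- Along the constant arc the parameter is the constant family through `δ_x`. [folklore] -/
theorem arcParam_constArc (x : E.Pt) (v : PlacesOver K p) (i : Fin n) :
    E.arcParam (E.constArc x) (E.constArc_mem_arcs x).1 v i = constFamily (E.param x v i) :=
  ContinuousMonoidHom.ext fun u => Units.ext (by
    rw [val_arcParam_apply, val_constFamily_apply, constArc_apply, E.eval_paramFn])

/-! #### Jets along arcs -/

/-- **The order-`m` weight jet along an arc** at `(v, i)`: the additive (to leading order)
function `coeff_m (κ_{v,i}(γ)/κ_{v,i}(x))` on `𝒪_{K_v}ˣ`. [folklore] -/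
def weightJet (γ : E.Fn →+* (PadicAlgCl p)⟦X⟧) (hγ : Continuous γ) (v : PlacesOver K p)
    (i : Fin n) (m : ℕ) : (v.1.adicCompletionIntegers K)ˣ → PadicAlgCl p :=
  charJet (E.arcWeight γ hγ v i) m

/-- **The leading weight jet** `d/ds|(κ_{v,i} ∘ γ)` along an arc — the quantity of crux
`WeightVelocityAtSteinbergPairs`; an additive character of `𝒪_{K_v}ˣ` (`leadingJet_mul`). [folklore] -/
def leadingWeightJet (γ : E.Fn →+* (PadicAlgCl p)⟦X⟧) (hγ : Continuous γ) (v : PlacesOver K p)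
    (i : Fin n) : (v.1.adicCompletionIntegers K)ˣ → PadicAlgCl p :=
  leadingJet (E.arcWeight γ hγ v i)

/-- The leading weight jet is additive. [folklore] -/
theorem leadingWeightJet_mul (γ : E.Fn →+* (PadicAlgCl p)⟦X⟧) (hγ : Continuous γ)
    (v : PlacesOver K p) (i : Fin n) (u u' : (v.1.adicCompletionIntegers K)ˣ) :
    E.leadingWeightJet γ hγ v i (u * u') = E.leadingWeightJet γ hγ v i u + E.leadingWeightJet γ hγ v i u' :=
  leadingJet_mul _ u u'

/-- **The gap character along an arc**: the ratio `δ_{v,i} δ_{v,j}⁻¹` of two components of the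
parameter along `γ` (for a consecutive pair `(i, i+1)` inside a Steinberg segment this is the
family whose first-order jet enters the Colmez–Greenberg–Stevens formula). [folklore] -/
def arcGap (γ : E.Fn →+* (PadicAlgCl p)⟦X⟧) (hγ : Continuous γ) (v : PlacesOver K p)
    (i j : Fin n) : (v.1.adicCompletion K)ˣ →ₜ* ((PadicAlgCl p)⟦X⟧)ˣ :=
  E.arcParam γ hγ v i / E.arcParam γ hγ v j

/-- Unfolding lemma for `arcGap` (pointwise ratio). [folklore] -/
@[simp] theorem arcGap_apply (γ : E.Fn →+* (PadicAlgCl p)⟦X⟧) (hγ : Continuous γ)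
    (v : PlacesOver K p) (i j : Fin n) (u : (v.1.adicCompletion K)ˣ) :
    E.arcGap γ hγ v i j u = E.arcParam γ hγ v i u / E.arcParam γ hγ v j u := rfl

/-- **The order-`m` jet of the gap character** `δ_{v,i}δ_{v,j}⁻¹` along an arc, a function on
`K_vˣ` (additive when the gap is flat below `m`, `charJet_mul`). [folklore] -/
def gapJet (γ : E.Fn →+* (PadicAlgCl p)⟦X⟧) (hγ : Continuous γ) (v : PlacesOver K p)
    (i j : Fin n) (m : ℕ) : (v.1.adicCompletion K)ˣ → PadicAlgCl p :=
  charJet (E.arcGap γ hγ v i j) m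

/-- The leading jet of the gap character along an arc (the `ψ` of
`δ̃_iδ̃_j⁻¹ = δ_iδ_j⁻¹(1 + s^m ψ + …)`), an additive character of `K_vˣ`. [folklore] -/
def leadingGapJet (γ : E.Fn →+* (PadicAlgCl p)⟦X⟧) (hγ : Continuous γ) (v : PlacesOver K p)
    (i j : Fin n) : (v.1.adicCompletion K)ˣ → PadicAlgCl p :=
  leadingJet (E.arcGap γ hγ v i j)

/-- The leading gap jet is additive. [folklore] -/
theorem leadingGapJet_mul (γ : E.Fn →+* (PadicAlgCl p)⟦X⟧) (hγ : Continuous γ)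
    (v : PlacesOver K p) (i j : Fin n) (u u' : (v.1.adicCompletion K)ˣ) :
    E.leadingGapJet γ hγ v i j (u * u') = E.leadingGapJet γ hγ v i j u + E.leadingGapJet γ hγ v i j u' :=
  leadingJet_mul _ u u'

/-- Along the constant arc all weight jets of positive order vanish. [folklore] -/
theorem weightJet_constArc (x : E.Pt) (v : PlacesOver K p) (i : Fin n) {m : ℕ} (hm : 0 < m)
    (u : (v.1.adicCompletionIntegers K)ˣ) :
    E.weightJet (E.constArc x) (E.constArc_mem_arcs x).1 v i m u = 0 := by
  have h : E.arcWeight (E.constArc x) (E.constArc_mem_arcs x).1 v i =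
      constFamily (E.weight x v i) := by
    refine ContinuousMonoidHom.ext fun u => Units.ext ?_
    change (E.constArc x) ((E.paramFn v i (integerUnitsToUnits v.1 u) : E.Fnˣ) : E.Fn) = _
    rw [constArc_apply, E.eval_paramFn]
    rfl
  rw [weightJet, h]
  exact charJet_constFamily _ hm u

/-! #### The properties -/

/-- **The weight map has discrete fibres** (Hansen Thm. 1.1.2 (i): "`w` has discrete fibers"):
every fibre `w⁻¹(κ) ⊆ Pt` is discrete in the (Zariski) topology.
[cite: HansenUniversalEigenvarieties2017, Thm. 1.1.2 (i)] -/
def HasDiscreteWeightFibres (E : EigenvarietyResGLn K n p S) : Prop :=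
  ∀ κ : PAdicWeight K n p (PadicAlgCl p), DiscreteTopology {x : E.Pt // E.weight x = κ}

/-- **Finiteness of bounded-slope eigenpackets of fixed weight** (Hansen, after Def. 1.1.1: "the
set of finite-slope eigenpackets of given weight and level which satisfy `v_p(φ(U_t)) ≤ h` is
finite"): for every weight `κ` and `c > 0` there are finitely many points of weight `κ` with
`‖φ_x(U_p)‖ ≥ c`. [cite: HansenUniversalEigenvarieties2017, §1.1 (after Def. 1.1.1)] -/
def HasFiniteSlopeFibres (E : EigenvarietyResGLn K n p S) : Prop :=
  ∀ (κ : PAdicWeight K n p (PadicAlgCl p)) (c : ℝ), 0 < c →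
    {x : E.Pt | E.weight x = κ ∧ c ≤ ‖E.controllingEigenvalue x‖}.Finite

/-- **Defect at good classical points**: `l(x) = l₀` for every interior, non-critical, regular
classical point (Hansen §1.1 p. 7: "interior, noncritical, regular classical points satisfy
`l(x) = l(G)`"; for `Res_{K/ℚ} GL_n`, `l(G) = r₁⌊(n-1)/2⌋ + r₂(n-1)`, `= [K⁺:ℚ](n-1)` for `K` CM),
so that `HasNewtonBoundWith d` gives `dim_x ≥ d − l₀` there (Thm. 1.1.6).
[cite: HansenUniversalEigenvarieties2017, §1.1 (p. 7) and Thm. 1.1.6] -/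
def HasClassicalDefect (l₀ : ℕ) : Prop :=
  ∀ x : E.Pt, x ∈ E.noncritical → x ∈ E.interior → x ∈ E.regular → E.defect x = l₀

/-- **Weights of level `U`** (`U` = the central global units `Z(K^p I) = 𝒪_Kˣ ∩ K^p I`): Hansen's
weight `λ_x` is trivial on the closure of `Z(K^p I)` (§2.2), which for `weight x = δ_x|_{T(ℤ_p)}`,
`δ_x(t) = ∏_i λ_{x,n+1-i}(t_i⁻¹) 𝐍t_i^{1-i}` (§1.2 (ii), `𝐍` the norm to `ℤ_pˣ`), reads
`weight x (diag(u,…,u)) = N_{K/ℚ}(u)^{-n(n-1)/2} = N_{K/ℚ}(u)^{n(n-1)/2}` (`N_{K/ℚ}(u) = ±1`).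
[cite: HansenUniversalEigenvarieties2017, §1.2 (ii) and §2.2 (p. 13)] -/
def HasWeightsOfLevel (U : Subgroup (𝓞 K)ˣ) : Prop :=
  ∀ x : E.Pt, ∀ u ∈ U, (E.weight x).centralValue u =
    ((Algebra.norm ℤ ((u : (𝓞 K)ˣ) : 𝓞 K) : ℤ) : PadicAlgCl p) ^ (n * (n - 1) / 2)

/-- **Existence of refined classical points** for a class `𝓒` of refined cuspidal representations
(the existence half of Bellaïche–Chenevier Def. 7.2.5 (iii), `Z ≅ 𝒵`; for Hansen's `𝒳` known for
eigenpackets of non-critical slope by the control theorem, Thm. 3.2.5 with Prop. 5.2.1, and to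
be posited by a route for the class it needs): every `(π, χ)` in `𝓒` with `χ_v` an exponent of a
local component at each `v ∣ p` has a point. [cite: BellaicheChenevier2009, Def. 7.2.5 (iii)]
[cite: HansenUniversalEigenvarieties2017, Thm. 3.2.5 and Prop. 5.2.1] -/
def HasRefinedClassicalPoints {hcpt : isCompact_glFiniteIntegralLevel n K} (ι : PadicAlgCl p ≃+* ℂ)
    (𝓒 : CuspidalAutomorphicRepData n K hcpt → RefinementExponent K n p → Prop) : Prop :=
  ∀ (π : CuspidalAutomorphicRepData n K hcpt) (χ : RefinementExponent K n p), 𝓒 π χ →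
    (∀ v : PlacesOver K p, ∃ πv : SmoothIrrep (GL (Fin n) (v.1.adicCompletion K)),
      π.1.HasLocalComponentAt v.1 πv.ρ ∧ IsJacquetExponent πv (χ v)) →
    ∃ x : E.Pt, E.IsClassicalPointOf ι x π χ

/-- `HasClassicalDefect` combined with Newton's bound: at an interior non-critical regular
classical point every irreducible component has dimension `≥ d − l₀`. [cite: HansenUniversalEigenvarieties2017, Thm. 1.1.6] -/
theorem newtonBound_of_hasClassicalDefect {l₀ d : ℕ} (hl : E.HasClassicalDefect l₀)
    (hN : E.HasNewtonBoundWith d) {x : E.Pt} (h₁ : x ∈ E.noncritical) (h₂ : x ∈ E.interior)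
    (h₃ : x ∈ E.regular) {C : Set E.Pt} (hC : C ∈ irreducibleComponents E.Pt) (hx : x ∈ C) :
    ((d - l₀ : ℕ) : WithBot ℕ∞) ≤ topologicalKrullDim C := by
  rw [← hl x h₁ h₂ h₃]
  exact hN x C hC hx

/-- `HasWeightsOfLevel` on squares of units needs no sign: `weight x (diag(u²)) = 1`. [folklore] -/
theorem centralValue_sq_of_hasWeightsOfLevel {U : Subgroup (𝓞 K)ˣ} (h : E.HasWeightsOfLevel U)
    (x : E.Pt) {u : (𝓞 K)ˣ} (hu : u ∈ U) :
    (E.weight x).centralValue (u * u) = (((Algebra.norm ℤ ((u : (𝓞 K)ˣ) : 𝓞 K) : ℤ) : PadicAlgCl p) ^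
      (n * (n - 1) / 2)) ^ 2 := by
  rw [PAdicWeight.centralValue_mul, h x u hu, sq]

end EigenvarietyResGLn

end Literature.NumberTheory.Automorphic

end
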